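import Summits.CriticalPhenomena.PercolationContinuityZ3.Theorems.PercNearOneGluingNoHeavyLowerTailQuantitativeHarrisSharpStrictness
import HarnessLib

/-!
# The TWO-CYLINDER floor: a LOCALISED explicit strictness of Harris' inequality
# (`Cov(f,g) ≥ w_e(1−w_e)·J₁·J₂·Π_{i ∈ R₁ ∪ R₂} m_i` when `D_e f ≥ J₁` on the cylinder `[η₁]_{R₁}` and `D_e g ≥ J₂` on `[η₂]_{R₂}` —
# the constant depends on the WITNESS CYLINDERS only, never on `|E|`)

Support file (`--supports stmt-CriticalPhenomena-4575`), prover seat `prim-rate-mine-2` (lane prim-rate, constants-miner (c), BENCH row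
M2-R49; `run/shared/lean/prim/prim-rate/prim-rate-mine-2/PROOFS.md` §P49).  No definitions, no named facts, no sorries; standard axioms.

The two-atom floor (row M2-R48, `QuantHarris.cov_ge_twoAtom`) prices EVERY coordinate `i ≠ e`: `q_i`, `1 − q_i` or `q_i(1−q_i)` — so on a support
`E` it is `(p₀(1−p₀))^{|E|}`, exponential in the VOLUME, and that is sharp for atom witnesses (AND/OR).  But a pivotality witness is usually a
CYLINDER: `D_e f(ζ) ≥ J₁` for every `ζ` agreeing with `η₁` on a set `R₁` of coordinates (for `f = 1{x ↔ o}`: the edges of one open path and of one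
closed cut-set), and then the coordinates outside `R₁ ∪ R₂` should cost NOTHING.  THIS FILE proves exactly that.

* `QuantHarris.cov_ge_twoCyl` (cube `ι → Bool`, product weight, `f, g` monotone `≥ 0`, `e ∉ R₁ ∪ R₂`, `J₁, J₂ ≥ 0`,
  `D_e f ≥ J₁` on `{ζ : ζ =_{R₁} η₁}`, `D_e g ≥ J₂` on `{ζ : ζ =_{R₂} η₂}`, and ANY `m : ι → ℝ≥0` dominated by the case table
  `m_i ≤ 1` off `R₁ ∪ R₂`, `m_i ≤ q_i^{η₁ i}(1−q_i)^{1−η₁ i}` on `R₁ ∖ R₂`, `m_i ≤ q_i^{η₂ i}(1−q_i)^{1−η₂ i}` on `R₂ ∖ R₁`, the same on `R₁ ∩ R₂`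
  where `η₁ i = η₂ i`, and `m_i ≤ q_i(1−q_i)` on `R₁ ∩ R₂` where `η₁ i ≠ η₂ i`):  **`q_e(1−q_e)·J₁·J₂·Π_{i ≠ e} m_i ≤ E(fg) − E f·E g`.**
  PROOF (`cov_ge_twoCyl_aux`, strong induction on the free coordinates `S`): a coordinate outside both cylinders is AVERAGED OUT
  (`Cov(f,g) = J_i(f,g) + Cov(E_i f, E_i g)`, `cov_eq_coinfluence_add_cov_condAvg`; the cylinder hypotheses survive averaging since
  `D_e E_i = E_i D_e`) at no cost; a coordinate constrained by one cylinder, or by both with the same value, is FROZEN at that value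
  (`cov_section_le`); when only doubly-constrained disagreeing coordinates remain, the two-atom floor `cov_ge_twoAtom_aux` finishes.
* `QuantHarris.cov_ge_twoCyl_prodBernoulli` — the same for `prodBernoulli w` on `Set ι`, cylinders `{ω : ∀ i ∈ R, i ∈ ω ↔ i ∈ η}`.
* **`QuantHarris.cov_ge_prodPow_cyl_mul_jumps`** — `p₀ ≤ w ≤ 1 − p₀` on a finite `E ∋ e` with `R₁ ∪ R₂ ⊆ R ⊆ E ∖ e` (weights off `E` arbitrary):
  **`(p₀(1−p₀))^{|R| + 1} · J₁ · J₂ ≤ ∫ fg dμ − ∫ f dμ·∫ g dμ`** — the explicit constant is LOCAL (exponent = size of the two witness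
  cylinders + 1), independent of `|E|`.  This is the positive answer to «is there a witness-localised floor independent of the volume?»; the
  negative datum of row M2-R48 (OR/OR needs `R = E ∖ e`) shows that the cylinder sizes, not the atom sizes, are the right parameter.
[cite: Harris1960, Lemma 4.1 (p. 16)] [cite: Talagrand1996, Thm. 1.1 (p. 244)]
-/

noncomputable section

namespace Summit.CriticalPhenomena.PercolationContinuityZ3.Theorems

namespace QuantHarris

open Finset Literature.Combinatorics.Sahi2008 SahiSubsetChord SahiCoSingleton

section Cube

variable {ι : Type*} [Fintype ι] [DecidableEq ι]

omit [Fintype ι] in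
/-- For `j ≠ i`, membership in `R.erase i` is membership in `R`. [folklore] -/
theorem mem_erase_iff_of_ne {R : Finset ι} {i j : ι} (h : j ≠ i) : j ∈ R.erase i ↔ j ∈ R := by
  rw [Finset.mem_erase]; exact ⟨fun h' => h'.2, fun h' => ⟨h, h'⟩⟩

omit [Fintype ι] in
/-- The conditional average over `i` ignores updates at `i` and outside the coordinates its argument depends on. [folklore] -/
theorem condAvg_update_eq {S : Finset ι} {f : (ι → Bool) → ℝ} (q : ι → ℝ) (i : ι)
    (hS : ∀ x a b, a ∉ S → f (Function.update x a b) = f x) :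
    ∀ x a b, a ∉ S.erase i → condAvg q i f (Function.update x a b) = condAvg q i f x := by
  intro x a b ha
  simp only [condAvg]
  rcases eq_or_ne a i with rfl | hne
  · rw [Function.update_idem, Function.update_idem]
  · have haS : a ∉ S := fun h' => ha (Finset.mem_erase.2 ⟨hne, h'⟩)
    rw [Function.update_comm hne, hS _ a b haS, Function.update_comm hne, hS _ a b haS]

/-- The joint influence `J_i(f,g) = q_i(1−q_i)·E[D_i f·D_i g]` of monotone `f, g` is nonnegative. [this file] -/
theorem coinfluence_nonneg' {q : ι → ℝ} (hq : ∀ i, 0 ≤ q i ∧ q i ≤ 1) {f g : (ι → Bool) → ℝ}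
    (hf : Monotone f) (hg : Monotone g) (i : ι) : 0 ≤ coinfluence q i f g :=
  mul_nonneg (mul_nonneg (hq i).1 (sub_nonneg.2 (hq i).2))
    (ex_nonneg (prodWeight_nonneg hq) fun x => mul_nonneg (pivDiff_nonneg hf i x) (pivDiff_nonneg hg i x))

/-- **The two-cylinder floor, inductive form.**  `f, g` nonnegative monotone depending only on `insert e S` (`e ∉ S`); cylinders
`(R₁, η₁)`, `(R₂, η₂)` with `R₁, R₂ ⊆ S` on which `D_e f ≥ J₁ ≥ 0`, `D_e g ≥ J₂ ≥ 0`; `m ≥ 0` dominated by the case table (module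
docstring).  Then `q_e(1−q_e)·J₁·J₂·Π_{i∈S} m_i ≤ Cov(f,g)`. [cite: Harris1960, Lemma 4.1 (p. 16)] [cite: Talagrand1996, Thm. 1.1 (p. 244)] -/
theorem cov_ge_twoCyl_aux {q : ι → ℝ} (hq : ∀ i, 0 ≤ q i ∧ q i ≤ 1) (e : ι) (η₁ η₂ : ι → Bool) (J₁ J₂ : ℝ) (hJ₁ : 0 ≤ J₁) (hJ₂ : 0 ≤ J₂)
    (m : ι → ℝ) (hm0 : ∀ i, 0 ≤ m i) (S : Finset ι) :
    e ∉ S → ∀ (R₁ R₂ : Finset ι), R₁ ⊆ S → R₂ ⊆ S →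
      (∀ i, i ∉ R₁ → i ∉ R₂ → m i ≤ 1) →
      (∀ i, i ∈ R₁ → i ∉ R₂ → m i ≤ (if η₁ i then q i else 1 - q i)) →
      (∀ i, i ∉ R₁ → i ∈ R₂ → m i ≤ (if η₂ i then q i else 1 - q i)) →
      (∀ i, i ∈ R₁ → i ∈ R₂ → η₁ i = η₂ i → m i ≤ (if η₁ i then q i else 1 - q i)) →
      (∀ i, i ∈ R₁ → i ∈ R₂ → η₁ i ≠ η₂ i → m i ≤ q i * (1 - q i)) →
      ∀ (f g : (ι → Bool) → ℝ), (∀ x, 0 ≤ f x) → (∀ x, 0 ≤ g x) → Monotone f → Monotone g →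
      (∀ x a b, a ∉ insert e S → f (Function.update x a b) = f x) →
      (∀ x a b, a ∉ insert e S → g (Function.update x a b) = g x) →
      (∀ ζ : ι → Bool, (∀ i ∈ R₁, ζ i = η₁ i) → J₁ ≤ pivDiff e f ζ) →
      (∀ ζ : ι → Bool, (∀ i ∈ R₂, ζ i = η₂ i) → J₂ ≤ pivDiff e g ζ) →
        q e * (1 - q e) * (J₁ * J₂) * ∏ i ∈ S, m i
          ≤ ex (prodWeight q) (f * g) - ex (prodWeight q) f * ex (prodWeight q) g := by
  induction S using Finset.strongInduction with
  | H S ih =>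
  intro heS R₁ R₂ hR₁ hR₂ hm1 hmA hmB hmC hmD f g hf0 hg0 hf hg hfS hgS hc₁ hc₂
  have hK0 : 0 ≤ q e * (1 - q e) := mul_nonneg (hq e).1 (sub_nonneg.2 (hq e).2)
  have hKJ : 0 ≤ q e * (1 - q e) * (J₁ * J₂) := mul_nonneg hK0 (mul_nonneg hJ₁ hJ₂)
  have hprod0 : ∀ T : Finset ι, 0 ≤ ∏ i ∈ T, m i := fun T => Finset.prod_nonneg fun i _ => hm0 i
  by_cases hfree : ∃ i ∈ S, i ∉ R₁ ∧ i ∉ R₂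
  · -- AVERAGE OUT a coordinate outside both cylinders (no cost)
    obtain ⟨i, hiS, hi1, hi2⟩ := hfree
    have hie : i ≠ e := fun h => heS (h ▸ hiS)
    have hsub : S.erase i ⊂ S := Finset.erase_ssubset hiS
    have heS' : e ∉ S.erase i := fun h => heS (Finset.mem_of_mem_erase h)
    have hR₁' : R₁ ⊆ S.erase i := fun j hj => Finset.mem_erase.2 ⟨fun h => hi1 (h ▸ hj), hR₁ hj⟩
    have hR₂' : R₂ ⊆ S.erase i := fun j hj => Finset.mem_erase.2 ⟨fun h => hi2 (h ▸ hj), hR₂ hj⟩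
    have hfS' : ∀ x a b, a ∉ insert e (S.erase i) → condAvg q i f (Function.update x a b) = condAvg q i f x := by
      have h := condAvg_update_eq q i hfS
      intro x a b ha
      refine h x a b fun h' => ha ?_
      rcases Finset.mem_insert.1 (Finset.mem_of_mem_erase h') with h'' | h''
      · exact h'' ▸ Finset.mem_insert_self _ _
      · exact Finset.mem_insert_of_mem (Finset.mem_erase.2 ⟨Finset.ne_of_mem_erase h', h''⟩)
    have hgS' : ∀ x a b, a ∉ insert e (S.erase i) → condAvg q i g (Function.update x a b) = condAvg q i g x := by
      have h := condAvg_update_eq q i hgS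
      intro x a b ha
      refine h x a b fun h' => ha ?_
      rcases Finset.mem_insert.1 (Finset.mem_of_mem_erase h') with h'' | h''
      · exact h'' ▸ Finset.mem_insert_self _ _
      · exact Finset.mem_insert_of_mem (Finset.mem_erase.2 ⟨Finset.ne_of_mem_erase h', h''⟩)
    have hc₁' : ∀ ζ : ι → Bool, (∀ j ∈ R₁, ζ j = η₁ j) → J₁ ≤ pivDiff e (condAvg q i f) ζ := by
      intro ζ hζ
      rw [pivDiff_condAvg q hie.symm f]
      simp only [condAvg]
      have h1 := hc₁ (Function.update ζ i true) fun j hj => by rw [Function.update_of_ne (fun h : j = i => hi1 (h ▸ hj))]; exact hζ j hj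
      have h0 := hc₁ (Function.update ζ i false) fun j hj => by rw [Function.update_of_ne (fun h : j = i => hi1 (h ▸ hj))]; exact hζ j hj
      nlinarith [(hq i).1, (hq i).2]
    have hc₂' : ∀ ζ : ι → Bool, (∀ j ∈ R₂, ζ j = η₂ j) → J₂ ≤ pivDiff e (condAvg q i g) ζ := by
      intro ζ hζ
      rw [pivDiff_condAvg q hie.symm g]
      simp only [condAvg]
      have h1 := hc₂ (Function.update ζ i true) fun j hj => by rw [Function.update_of_ne (fun h : j = i => hi2 (h ▸ hj))]; exact hζ j hj
      have h0 := hc₂ (Function.update ζ i false) fun j hj => by rw [Function.update_of_ne (fun h : j = i => hi2 (h ▸ hj))]; exact hζ j hj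
      nlinarith [(hq i).1, (hq i).2]
    have IH := ih (S.erase i) hsub heS' R₁ R₂ hR₁' hR₂' hm1 hmA hmB hmC hmD (condAvg q i f) (condAvg q i g)
      (condAvg_nonneg hq hf0 i) (condAvg_nonneg hq hg0 i) (condAvg_mono hq hf i) (condAvg_mono hq hg i) hfS' hgS' hc₁' hc₂'
    have hmi : m i ≤ 1 := hm1 i hi1 hi2
    rw [← Finset.mul_prod_erase S m hiS, cov_eq_coinfluence_add_cov_condAvg q i f g]
    have hJi := coinfluence_nonneg' hq hf hg i
    calc q e * (1 - q e) * (J₁ * J₂) * (m i * ∏ j ∈ S.erase i, m j)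
        ≤ q e * (1 - q e) * (J₁ * J₂) * (1 * ∏ j ∈ S.erase i, m j) :=
          mul_le_mul_of_nonneg_left (mul_le_mul_of_nonneg_right hmi (hprod0 _)) hKJ
      _ = q e * (1 - q e) * (J₁ * J₂) * ∏ j ∈ S.erase i, m j := by ring
      _ ≤ _ := by linarith [IH]
  push Not at hfree
  by_cases hfreeze : ∃ i ∈ S, ¬ (i ∈ R₁ ∧ i ∈ R₂ ∧ η₁ i ≠ η₂ i)
  · -- FREEZE a coordinate constrained by one cylinder, or by both with a common value
    obtain ⟨i, hiS, hi⟩ := hfreeze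
    have hie : i ≠ e := fun h => heS (h ▸ hiS)
    have hsub : S.erase i ⊂ S := Finset.erase_ssubset hiS
    have heS' : e ∉ S.erase i := fun h => heS (Finset.mem_of_mem_erase h)
    have hiR : i ∈ R₁ ∨ i ∈ R₂ := by
      by_cases h1 : i ∈ R₁
      · exact Or.inl h1
      · exact Or.inr (hfree i hiS h1)
    -- the frozen value
    set b : Bool := if i ∈ R₁ then η₁ i else η₂ i with hb
    have hb1 : i ∈ R₁ → b = η₁ i := fun h => by simp [hb, h]
    have hb2 : i ∈ R₂ → b = η₂ i := by
      intro h2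
      by_cases h1 : i ∈ R₁
      · have : η₁ i = η₂ i := by
          by_contra hne
          exact hi ⟨h1, h2, hne⟩
        rw [hb1 h1, this]
      · simp [hb, h1]
    have hmi : m i ≤ (if b then q i else 1 - q i) := by
      by_cases h1 : i ∈ R₁
      · by_cases h2 : i ∈ R₂
        · have heq : η₁ i = η₂ i := by
            by_contra hne
            exact hi ⟨h1, h2, hne⟩
          rw [hb1 h1]; exact hmC i h1 h2 heq
        · rw [hb1 h1]; exact hmA i h1 h2
      · have h2 : i ∈ R₂ := hiR.resolve_left h1
        rw [hb2 h2]; exact hmB i h1 h2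
    have hT : ∀ a', a' ∉ insert e (S.erase i) → a' ≠ i → a' ∉ insert e S := by
      intro a' ha' hne h'
      rcases Finset.mem_insert.1 h' with rfl | h''
      · exact ha' (Finset.mem_insert_self _ _)
      · exact ha' (Finset.mem_insert_of_mem (Finset.mem_erase.2 ⟨hne, h''⟩))
    have hR₁' : R₁.erase i ⊆ S.erase i := Finset.erase_subset_erase i hR₁
    have hR₂' : R₂.erase i ⊆ S.erase i := Finset.erase_subset_erase i hR₂
    -- the case table for the erased cylinders
    have hm1' : ∀ j, j ∉ R₁.erase i → j ∉ R₂.erase i → m j ≤ 1 := by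
      intro j hj1 hj2
      rcases eq_or_ne j i with rfl | hji
      · calc m j ≤ (if b then q j else 1 - q j) := hmi
          _ ≤ 1 := by split_ifs; exact (hq j).2; linarith [(hq j).1]
      · exact hm1 j (fun h => hj1 ((mem_erase_iff_of_ne hji).2 h)) (fun h => hj2 ((mem_erase_iff_of_ne hji).2 h))
    have hmA' : ∀ j, j ∈ R₁.erase i → j ∉ R₂.erase i → m j ≤ (if η₁ j then q j else 1 - q j) := fun j hj1 hj2 =>
      hmA j (Finset.mem_of_mem_erase hj1) (fun h => hj2 ((mem_erase_iff_of_ne (Finset.ne_of_mem_erase hj1)).2 h))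
    have hmB' : ∀ j, j ∉ R₁.erase i → j ∈ R₂.erase i → m j ≤ (if η₂ j then q j else 1 - q j) := fun j hj1 hj2 =>
      hmB j (fun h => hj1 ((mem_erase_iff_of_ne (Finset.ne_of_mem_erase hj2)).2 h)) (Finset.mem_of_mem_erase hj2)
    have hmC' : ∀ j, j ∈ R₁.erase i → j ∈ R₂.erase i → η₁ j = η₂ j → m j ≤ (if η₁ j then q j else 1 - q j) := fun j hj1 hj2 h =>
      hmC j (Finset.mem_of_mem_erase hj1) (Finset.mem_of_mem_erase hj2) h
    have hmD' : ∀ j, j ∈ R₁.erase i → j ∈ R₂.erase i → η₁ j ≠ η₂ j → m j ≤ q j * (1 - q j) := fun j hj1 hj2 h =>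
      hmD j (Finset.mem_of_mem_erase hj1) (Finset.mem_of_mem_erase hj2) h
    -- the sections and their cylinder hypotheses
    have hc₁' : ∀ ζ : ι → Bool, (∀ j ∈ R₁.erase i, ζ j = η₁ j) → J₁ ≤ pivDiff e (fun x => f (Function.update x i b)) ζ := by
      intro ζ hζ
      have h := hc₁ (Function.update ζ i b) fun j hj => by
        rcases eq_or_ne j i with rfl | hji
        · rw [Function.update_self, hb1 hj]
        · rw [Function.update_of_ne hji]; exact hζ j (Finset.mem_erase.2 ⟨hji, hj⟩)
      simp only [pivDiff] at h ⊢
      rwa [Function.update_comm hie, Function.update_comm hie] at h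
    have hc₂' : ∀ ζ : ι → Bool, (∀ j ∈ R₂.erase i, ζ j = η₂ j) → J₂ ≤ pivDiff e (fun x => g (Function.update x i b)) ζ := by
      intro ζ hζ
      have h := hc₂ (Function.update ζ i b) fun j hj => by
        rcases eq_or_ne j i with rfl | hji
        · rw [Function.update_self, hb2 hj]
        · rw [Function.update_of_ne hji]; exact hζ j (Finset.mem_erase.2 ⟨hji, hj⟩)
      simp only [pivDiff] at h ⊢
      rwa [Function.update_comm hie, Function.update_comm hie] at h
    have IH := ih (S.erase i) hsub heS' (R₁.erase i) (R₂.erase i) hR₁' hR₂' hm1' hmA' hmB' hmC' hmD'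
      (fun x => f (Function.update x i b)) (fun x => g (Function.update x i b)) (fun x => hf0 _) (fun x => hg0 _)
      (monotone_comp_update hf i b) (monotone_comp_update hg i b) (section_update_eq hfS i b hT) (section_update_eq hgS i b hT) hc₁' hc₂'
    have hsec := cov_section_le hq i b hf0 hg0 hf hg
    have hfac0 : 0 ≤ (if b then q i else 1 - q i) := by
      split_ifs
      · exact (hq i).1
      · exact sub_nonneg.2 (hq i).2
    rw [← Finset.mul_prod_erase S m hiS]
    calc q e * (1 - q e) * (J₁ * J₂) * (m i * ∏ j ∈ S.erase i, m j)
        ≤ q e * (1 - q e) * (J₁ * J₂) * ((if b then q i else 1 - q i) * ∏ j ∈ S.erase i, m j) :=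
          mul_le_mul_of_nonneg_left (mul_le_mul_of_nonneg_right hmi (hprod0 _)) hKJ
      _ = (if b then q i else 1 - q i) * (q e * (1 - q e) * (J₁ * J₂) * ∏ j ∈ S.erase i, m j) := by ring
      _ ≤ (if b then q i else 1 - q i) *
            (ex (prodWeight q) ((fun x => f (Function.update x i b)) * fun x => g (Function.update x i b))
              - ex (prodWeight q) (fun x => f (Function.update x i b)) * ex (prodWeight q) (fun x => g (Function.update x i b))) :=
          mul_le_mul_of_nonneg_left IH hfac0
      _ ≤ _ := hsec
  · -- only doubly-constrained disagreeing coordinates remain: the two-atom floor finishes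
    push Not at hfreeze
    have hJf : J₁ ≤ pivDiff e f η₁ := hc₁ η₁ fun _ _ => rfl
    have hJg : J₂ ≤ pivDiff e g η₂ := hc₂ η₂ fun _ _ => rfl
    have htwo := cov_ge_twoAtom_aux hq e S heS f g hf0 hg0 hf hg hfS hgS η₁ η₂
    have hmle : ∏ i ∈ S, m i ≤ ∏ i ∈ S, (if η₁ i = η₂ i then (if η₁ i then q i else 1 - q i) else q i * (1 - q i)) := by
      refine Finset.prod_le_prod (fun i _ => hm0 i) fun i hi => ?_
      obtain ⟨h1, h2, hne⟩ := hfreeze i hi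
      rw [if_neg hne]
      exact hmD i h1 h2 hne
    have hP0 : 0 ≤ ∏ i ∈ S, (if η₁ i = η₂ i then (if η₁ i then q i else 1 - q i) else q i * (1 - q i)) :=
      Finset.prod_nonneg fun i _ => by
        split_ifs
        · exact (hq i).1
        · exact sub_nonneg.2 (hq i).2
        · exact mul_nonneg (hq i).1 (sub_nonneg.2 (hq i).2)
    have hJJ : J₁ * J₂ ≤ pivDiff e f η₁ * pivDiff e g η₂ := mul_le_mul hJf hJg hJ₂ (hJ₁.trans hJf)
    calc q e * (1 - q e) * (J₁ * J₂) * ∏ i ∈ S, m i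
        ≤ q e * (1 - q e) * (J₁ * J₂) * ∏ i ∈ S, (if η₁ i = η₂ i then (if η₁ i then q i else 1 - q i) else q i * (1 - q i)) :=
          mul_le_mul_of_nonneg_left hmle hKJ
      _ ≤ q e * (1 - q e) * (pivDiff e f η₁ * pivDiff e g η₂) *
            ∏ i ∈ S, (if η₁ i = η₂ i then (if η₁ i then q i else 1 - q i) else q i * (1 - q i)) :=
          mul_le_mul_of_nonneg_right (mul_le_mul_of_nonneg_left hJJ hK0) hP0
      _ ≤ _ := htwo

/-- **THE TWO-CYLINDER FLOOR (localised explicit strictness of Harris, cube form).**  Product weight `prodWeight q`, `q ∈ [0,1]^ι`; `f, g`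
nonnegative monotone; a coordinate `e`, cylinders `(R₁, η₁)`, `(R₂, η₂)` with `e ∉ R₁ ∪ R₂` such that `D_e f ≥ J₁ ≥ 0` whenever the configuration
agrees with `η₁` on `R₁` and `D_e g ≥ J₂ ≥ 0` whenever it agrees with `η₂` on `R₂`; `m ≥ 0` dominated by the case table (`≤ 1` off `R₁ ∪ R₂`,
`≤ q_i^{η i}(1−q_i)^{1−η i}` where exactly one cylinder (or both, agreeing) constrains `i`, `≤ q_i(1−q_i)` where they disagree).  Then
`q_e(1−q_e)·J₁·J₂·Π_{i ≠ e} m_i ≤ E(fg) − E f·E g`. [cite: Harris1960, Lemma 4.1 (p. 16)] [cite: Talagrand1996, Thm. 1.1 (p. 244)] -/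
theorem cov_ge_twoCyl {q : ι → ℝ} (hq : ∀ i, 0 ≤ q i ∧ q i ≤ 1) (f g : (ι → Bool) → ℝ)
    (hf0 : ∀ x, 0 ≤ f x) (hg0 : ∀ x, 0 ≤ g x) (hf : Monotone f) (hg : Monotone g) (e : ι)
    (R₁ R₂ : Finset ι) (heR₁ : e ∉ R₁) (heR₂ : e ∉ R₂) (η₁ η₂ : ι → Bool) (J₁ J₂ : ℝ) (hJ₁ : 0 ≤ J₁) (hJ₂ : 0 ≤ J₂)
    (hc₁ : ∀ ζ : ι → Bool, (∀ i ∈ R₁, ζ i = η₁ i) → J₁ ≤ pivDiff e f ζ)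
    (hc₂ : ∀ ζ : ι → Bool, (∀ i ∈ R₂, ζ i = η₂ i) → J₂ ≤ pivDiff e g ζ)
    (m : ι → ℝ) (hm0 : ∀ i, 0 ≤ m i) (hm1 : ∀ i, i ∉ R₁ → i ∉ R₂ → m i ≤ 1)
    (hmA : ∀ i, i ∈ R₁ → i ∉ R₂ → m i ≤ (if η₁ i then q i else 1 - q i))
    (hmB : ∀ i, i ∉ R₁ → i ∈ R₂ → m i ≤ (if η₂ i then q i else 1 - q i))
    (hmC : ∀ i, i ∈ R₁ → i ∈ R₂ → η₁ i = η₂ i → m i ≤ (if η₁ i then q i else 1 - q i))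
    (hmD : ∀ i, i ∈ R₁ → i ∈ R₂ → η₁ i ≠ η₂ i → m i ≤ q i * (1 - q i)) :
    q e * (1 - q e) * (J₁ * J₂) * ∏ i ∈ (univ : Finset ι).erase e, m i
      ≤ ex (prodWeight q) (f * g) - ex (prodWeight q) f * ex (prodWeight q) g := by
  have hu : insert e ((univ : Finset ι).erase e) = univ := Finset.insert_erase (Finset.mem_univ e)
  exact cov_ge_twoCyl_aux hq e η₁ η₂ J₁ J₂ hJ₁ hJ₂ m hm0 ((univ : Finset ι).erase e) (Finset.notMem_erase e univ) R₁ R₂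
    (fun i hi => Finset.mem_erase.2 ⟨fun h => heR₁ (h ▸ hi), Finset.mem_univ i⟩)
    (fun i hi => Finset.mem_erase.2 ⟨fun h => heR₂ (h ▸ hi), Finset.mem_univ i⟩)
    hm1 hmA hmB hmC hmD f g hf0 hg0 hf hg
    (fun x a b ha => absurd (by rw [hu]; exact Finset.mem_univ a) ha)
    (fun x a b ha => absurd (by rw [hu]; exact Finset.mem_univ a) ha) hc₁ hc₂

end Cube

/-! ### The product measure `prodBernoulli w` on `Set ι` -/

section ProdBernoulli

open MeasureTheory Set Literature.Probability.LatticeModels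
open scoped Classical

variable {ι : Type*} [Fintype ι]

/-- **The two-cylinder floor for the product measure (LOCALISED explicit strictness of Harris).**  Weights with `p₀ ≤ w ≤ 1 − p₀` on a
finite set `E` (`0 ≤ p₀`; the weights OFF `E` are arbitrary — no support hypothesis); `f, g : Set ι → ℝ` monotone nonnegative; `e ∈ E`;
cylinders `(R₁, η₁)`, `(R₂, η₂)` with `R₁ ∪ R₂ ⊆ R ⊆ E ∖ e` (`R` any common bound, optimally `R₁ ∪ R₂`), such that `f(ω ∪ {e}) − f(ω ∖ {e}) ≥ J₁ ≥ 0` for every `ω` agreeing with `η₁` on `R₁` and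
`g(ω ∪ {e}) − g(ω ∖ {e}) ≥ J₂ ≥ 0` for every `ω` agreeing with `η₂` on `R₂`.  Then
**`(p₀(1−p₀))^{|R| + 1} · J₁ · J₂ ≤ ∫ fg dμ − ∫ f dμ · ∫ g dμ`** — the constant depends on the witness cylinders, not on `|E|`.
[cite: Harris1960, Lemma 4.1 (p. 16)] [cite: Talagrand1996, Thm. 1.1 (p. 244)] -/
theorem cov_ge_prodPow_cyl_mul_jumps (w : ι → unitInterval) (E : Finset ι) (p₀ : ℝ) (hp0 : 0 ≤ p₀)
    (hE1 : ∀ i ∈ E, p₀ ≤ (w i : ℝ) ∧ (w i : ℝ) ≤ 1 - p₀)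
    (f g : Set ι → ℝ) (hf0 : ∀ ω, 0 ≤ f ω) (hg0 : ∀ ω, 0 ≤ g ω) (hf : Monotone f) (hg : Monotone g)
    (e : ι) (he : e ∈ E) (R R₁ R₂ : Finset ι) (hR : R ⊆ E) (hR₁ : R₁ ⊆ R) (hR₂ : R₂ ⊆ R) (heR : e ∉ R)
    (η₁ η₂ : Set ι) (J₁ J₂ : ℝ) (hJ₁ : 0 ≤ J₁) (hJ₂ : 0 ≤ J₂)
    (hc₁ : ∀ ω : Set ι, (∀ i ∈ R₁, (i ∈ ω ↔ i ∈ η₁)) → J₁ ≤ f (insert e ω) - f (ω \ {e}))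
    (hc₂ : ∀ ω : Set ι, (∀ i ∈ R₂, (i ∈ ω ↔ i ∈ η₂)) → J₂ ≤ g (insert e ω) - g (ω \ {e})) :
    (p₀ * (1 - p₀)) ^ (R.card + 1) * (J₁ * J₂) ≤
      ∫ ω, f ω * g ω ∂(prodBernoulli w) - (∫ ω, f ω ∂(prodBernoulli w)) * ∫ ω, g ω ∂(prodBernoulli w) := by
  have hq : ∀ i, 0 ≤ (w i : ℝ) ∧ (w i : ℝ) ≤ 1 := fun i => ⟨(w i).2.1, (w i).2.2⟩
  -- the constant `m`: `p₀(1−p₀)` on the cylinders' coordinates, `1` elsewhere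
  set c : ℝ := p₀ * (1 - p₀) with hc
  have hp1 : p₀ ≤ 1 - p₀ := (hE1 e he).1.trans (hE1 e he).2
  have hc0 : 0 ≤ c := mul_nonneg hp0 (hp0.trans hp1)
  have hcp : c ≤ p₀ := by rw [hc]; nlinarith
  have heR₁ : e ∉ R₁ := fun h => heR (hR₁ h)
  have heR₂ : e ∉ R₂ := fun h => heR (hR₂ h)
  have hc1 : c ≤ 1 := by rw [hc]; nlinarith
  have hfacR : ∀ i ∈ R, ∀ b : Bool, c ≤ (if b then (w i : ℝ) else 1 - w i) := by
    intro i hi b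
    have hiE : i ∈ E := hR hi
    cases b
    · simp only [Bool.false_eq_true, if_false]; linarith [(hE1 i hiE).2]
    · simp only [if_true]; exact hcp.trans (hE1 i hiE).1
  have hmixR : ∀ i ∈ R, c ≤ (w i : ℝ) * (1 - w i) := by
    intro i hi
    have hiE : i ∈ E := hR hi
    rw [hc]; nlinarith [mul_nonneg (sub_nonneg.2 (hE1 i hiE).1) (sub_nonneg.2 (hE1 i hiE).2)]
  set m : ι → ℝ := fun i => if i ∈ R then c else 1 with hm
  have hm0 : ∀ i, 0 ≤ m i := fun i => by simp only [hm]; split_ifs; exacts [hc0, zero_le_one]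
  have h := cov_ge_twoCyl hq (fun x => f {i | x i = true}) (fun x => g {i | x i = true})
    (fun _ => hf0 _) (fun _ => hg0 _) (monotone_comp_setOf hf) (monotone_comp_setOf hg) e R₁ R₂ heR₁ heR₂
    η₁.boolIndicator η₂.boolIndicator J₁ J₂ hJ₁ hJ₂ ?_ ?_ m hm0 ?_ ?_ ?_ ?_ ?_
  · rw [ex_prodWeight_eq_integral, ex_prodWeight_eq_integral, ex_prodWeight_eq_integral] at h
    simp only [Pi.mul_apply, setOf_boolIndicator] at h
    -- the product of `m` over `univ ∖ e` is `c ^ |R|`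
    have hprod : ∏ i ∈ (Finset.univ : Finset ι).erase e, m i = c ^ R.card := by
      have hsub : R ⊆ (Finset.univ : Finset ι).erase e := fun i hi =>
        Finset.mem_erase.2 ⟨by rintro rfl; exact heR hi, Finset.mem_univ i⟩
      rw [← Finset.prod_subset hsub (fun i _ hi => by simp only [hm, if_neg hi])]
      rw [Finset.prod_congr rfl (fun i hi => by simp only [hm, if_pos hi] : ∀ i ∈ R, m i = c), Finset.prod_const]
    rw [hprod] at h
    have hwe : c ≤ (w e : ℝ) * (1 - w e) := by
      rw [hc]; nlinarith [mul_nonneg (sub_nonneg.2 (hE1 e he).1) (sub_nonneg.2 (hE1 e he).2)]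
    have hwe0 : 0 ≤ (w e : ℝ) * (1 - w e) := mul_nonneg (w e).2.1 (sub_nonneg.2 (w e).2.2)
    calc c ^ (R.card + 1) * (J₁ * J₂) = c * (J₁ * J₂) * c ^ R.card := by rw [pow_succ]; ring
      _ ≤ (w e : ℝ) * (1 - w e) * (J₁ * J₂) * c ^ R.card :=
          mul_le_mul_of_nonneg_right (mul_le_mul_of_nonneg_right hwe (mul_nonneg hJ₁ hJ₂)) (pow_nonneg hc0 _)
      _ ≤ _ := h
  · intro ζ hζ
    set ω : Set ι := {i | ζ i = true} with hω
    have hζω : ζ = ω.boolIndicator := by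
      funext i
      by_cases h : ζ i = true
      · rw [h]; exact ((Set.mem_iff_boolIndicator ω i).1 h).symm
      · have h' : ζ i = false := by simpa using h
        rw [h']; exact ((Set.notMem_iff_boolIndicator ω i).1 h).symm
    have h1 := hc₁ ω fun i hi => by
      rw [hω, Set.mem_setOf_eq, hζ i hi]; exact (Set.mem_iff_boolIndicator η₁ i).symm
    rw [hζω]
    simp only [pivDiff, setOf_update_true, setOf_update_false]
    exact h1
  · intro ζ hζ
    set ω : Set ι := {i | ζ i = true} with hω
    have hζω : ζ = ω.boolIndicator := by
      funext i
      by_cases h : ζ i = true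
      · rw [h]; exact ((Set.mem_iff_boolIndicator ω i).1 h).symm
      · have h' : ζ i = false := by simpa using h
        rw [h']; exact ((Set.notMem_iff_boolIndicator ω i).1 h).symm
    have h1 := hc₂ ω fun i hi => by
      rw [hω, Set.mem_setOf_eq, hζ i hi]; exact (Set.mem_iff_boolIndicator η₂ i).symm
    rw [hζω]
    simp only [pivDiff, setOf_update_true, setOf_update_false]
    exact h1
  · intro i _ _
    simp only [hm]
    split_ifs
    · exact hc1
    · exact le_rfl
  · intro i h1 _
    simp only [hm, if_pos (hR₁ h1)]; exact hfacR i (hR₁ h1) _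
  · intro i _ h2
    simp only [hm, if_pos (hR₂ h2)]; exact hfacR i (hR₂ h2) _
  · intro i h1 _ _
    simp only [hm, if_pos (hR₁ h1)]; exact hfacR i (hR₁ h1) _
  · intro i h1 _ _
    simp only [hm, if_pos (hR₁ h1)]; exact hmixR i (hR₁ h1)

end ProdBernoulli

end QuantHarris

end Summit.CriticalPhenomena.PercolationContinuityZ3.Theorems

end
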